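import Literature.Analysis.FunctionSpaces.TorusTranslationEstimate
import Literature.Analysis.FunctionSpaces.TorusMaximalLipschitz
import Literature.Analysis.FunctionSpaces.TorusMollifier
import Literature.Analysis.FunctionSpaces.TorusConvolution
import HarnessLib

/-!
# The DiPerna–Lions commutator of a mollification in `L¹` (quantitative `L² × H¹` form)

Analysis/FunctionSpaces support file (everything proved). It serves the discharge of the named
facts `Literature.Analysis.FluidPDE.Seis2022_rmk1_L2` / `Seis2022_thm2_L2`
(`FluidPDE/SeisDissipationRateBound`), where a weak solution `θ ∈ L^∞_t L²_x` of the
advection–diffusion equation with velocity `u ∈ L²_x`, `‖∇u‖_{L²} < ∞`, is regularised in space,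
`θ_ε = θ ⋆ k_ε`, and the defect `(θu) ⋆ k_ε - θ_ε u` has to be paid in `L¹` against a
`δ⁻¹`-Lipschitz potential (DiPerna–Lions 1989, Lemma II.1 / Thm. II.1, the commutator lemma, in
the quantitative `L² × H¹ → L¹` form).

* the translation input is the tree's `Torus.eLpNorm_sub_translate_le`
  (`TorusTranslationEstimate`): `‖u(· + proj v) - u‖_{L²} ≤ ‖v‖ (eGradNormSq u)^{1/2}`;
* the geometric input `‖reprc z‖ ≤ √d ‖z‖` is the tree's `Torus.norm_reprc_le_sqrt_card_mul_norm`
  (`TorusMaximalLipschitz`);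
* `Torus.lintegral_enorm_mollifyCommutator_le` — **the commutator estimate**: for `θ ∈ L²`,
  `u ∈ L²(T^d; ℝ^d)` and `0 < ε ≤ 1/4`,
  `∫ ‖∫ θ(y) k_ε(x-y) u(y) dy - (θ ⋆ k_ε)(x) u(x)‖ dx ≤ √d · ε · ‖θ‖_{L²} · (eGradNormSq u)^{1/2}`
  (the commutator equals `∫ θ(y) k_ε(x-y) (u(y) - u(x)) dy`; Tonelli, the substitution
  `x = y + z`, Cauchy–Schwarz in `y`, the translation bound at `v = reprc z`,
  `‖reprc z‖ ≤ √d ‖z‖ < √d ε` on the support of the kernel).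

## Mathlib / tree search

Mathlib (this pin): Hölder `ENNReal.lintegral_mul_le_Lp_mul_Lq`, `AddCircle.norm_coe_eq_abs_iff`;
no commutator lemmas (`Mathlib/Analysis/Convolution`: none). Tree: `Torus.eLpNorm_sub_translate_le`
(`TorusTranslationEstimate`, the `L²` translation bound by the spectral enstrophy), the mollifier
`Torus.kernel` (`TorusMollifier`, `TorusConvolution`); the CET commutator of `TorusCommutatorEstimate`
is the cubic `L³` Onsager version, not this one.

## References

* R. J. DiPerna, P.-L. Lions, *Ordinary differential equations, transport theory and Sobolev
  spaces*, Invent. Math. 98 (1989), 511–547, Lemma II.1 and its proof. [`DiPernaLions1989`]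
* C. Seis, Comm. Math. Phys. 399 (2023) = arXiv:2003.08794, §2.2 (consumer). [`Seis2022`]
-/

noncomputable section

open MeasureTheory Set Filter Metric Function UnitAddTorus
open scoped ENNReal NNReal Convolution InnerProductSpace Topology

namespace Literature.Analysis.FunctionSpaces

namespace Torus

variable {d : Type*} [Fintype d]

/-! ## The commutator estimate -/

section Commutator

variable {θ : UnitAddTorus d → ℝ} {u : UnitAddTorus d → EuclideanSpace ℝ d} {ε : ℝ}

/-- `θ u ∈ L¹` for `θ, u ∈ L²`. [folklore] -/
theorem integrable_smul_of_memLp_two (hθ : MemLp θ 2 volume) (hu : MemLp u 2 volume) :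
    Integrable (fun y => θ y • u y) volume :=
  memLp_one_iff_integrable.1 (MemLp.smul (r := 1) hu hθ)

/-- The first term of the commutator, `x ↦ ∫ θ(y) k_ε(x - y) u(y) dy`, is the mollification of
`θ u ∈ L¹` and its integrand is integrable for every `x`. [folklore] -/
theorem integrable_mul_kernel_smul (hθ : MemLp θ 2 volume) (hu : MemLp u 2 volume) (hε : 0 < ε)
    (hε' : ε ≤ 1 / 4) (x : UnitAddTorus d) :
    Integrable (fun y => (θ y * kernel ε (x - y)) • u y) volume := by
  have hk := continuous_kernel (d := d) hε hε'
  obtain ⟨C, hC⟩ := exists_forall_norm_le_of_continuous hk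
  have h1 : Integrable (fun y => kernel ε (x - y) • (θ y • u y)) volume :=
    (integrable_smul_of_memLp_two hθ hu).bdd_smul C
      (hk.comp (continuous_const.sub continuous_id)).aestronglyMeasurable
      (Eventually.of_forall fun y => hC _)
  refine h1.congr (Eventually.of_forall fun y => ?_)
  show kernel ε (x - y) • (θ y • u y) = (θ y * kernel ε (x - y)) • u y
  rw [smul_smul, mul_comm]

/-- **The commutator as a kernel average of velocity increments**:
`∫ θ(y) k_ε(x-y) u(y) dy - (θ ⋆ k_ε)(x) u(x) = ∫ θ(y) k_ε(x-y) (u(y) - u(x)) dy`. [folklore] -/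
theorem mollifyCommutator_eq (hθ : MemLp θ 2 volume) (hu : MemLp u 2 volume) (hε : 0 < ε)
    (hε' : ε ≤ 1 / 4) (x : UnitAddTorus d) :
    (∫ y, (θ y * kernel ε (x - y)) • u y) - (θ ⋆ kernel ε) x • u x =
      ∫ y, (θ y * kernel ε (x - y)) • (u y - u x) := by
  have hθi : Integrable θ volume := hθ.integrable one_le_two
  have hi1 := integrable_mul_kernel_smul hθ hu hε hε' x
  have hi2 : Integrable (fun y => (θ y * kernel ε (x - y)) • u x) volume :=
    (integrable_smul_comp_sub hθi (continuous_kernel hε hε') x).smul_const _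
  simp_rw [smul_sub]
  rw [integral_sub hi1 hi2, integral_smul_const, convolution_lsmul]
  simp only [smul_eq_mul]

/-- **The DiPerna–Lions commutator estimate in `L¹` (quantitative `L² × H¹` form).** For
`θ ∈ L²(T^d)`, `u ∈ L²(T^d; ℝ^d)` and `0 < ε ≤ 1/4`:
`∫ ‖∫ θ(y) k_ε(x-y) u(y) dy - (θ ⋆ k_ε)(x) u(x)‖ dx ≤ √d · ε · ‖θ‖_{L²} · (eGradNormSq u)^{1/2}`
(DiPerna–Lions 1989, Lemma II.1: the commutator `(θu) ⋆ k_ε - (θ ⋆ k_ε) u` is controlled by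
`‖θ‖_{L²} ‖∇u‖_{L²}`, here with the explicit factor `ε` that makes it vanish as `ε → 0`).
[cite: DiPernaLions1989, Lemma II.1 (proof)] -/
theorem lintegral_enorm_mollifyCommutator_le (hθ : MemLp θ 2 volume) (hu : MemLp u 2 volume)
    (hε : 0 < ε) (hε' : ε ≤ 1 / 4) :
    ∫⁻ x, ‖(∫ y, (θ y * kernel ε (x - y)) • u y) - (θ ⋆ kernel ε) x • u x‖ₑ ≤
      ENNReal.ofReal (Real.sqrt (Fintype.card d) * ε) * eLpNorm θ 2 volume *
        eGradNormSq u ^ (1 / 2 : ℝ) := by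
  have hk := continuous_kernel (d := d) hε hε'
  set G := eGradNormSq u ^ (1 / 2 : ℝ) with hG
  -- Step 1: pointwise, the commutator is bounded by a kernel average of increments
  have h1 : ∀ x : UnitAddTorus d, ‖(∫ y, (θ y * kernel ε (x - y)) • u y) - (θ ⋆ kernel ε) x • u x‖ₑ ≤
      ∫⁻ y, ‖θ y‖ₑ * ENNReal.ofReal (kernel ε (x - y)) * ‖u y - u x‖ₑ := fun x => by
    rw [mollifyCommutator_eq hθ hu hε hε' x]
    refine (enorm_integral_le_lintegral_enorm _).trans (lintegral_mono fun y => ?_)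
    rw [enorm_smul, enorm_mul, Real.enorm_eq_ofReal (kernel_nonneg hε.le _)]
  -- Step 2: Tonelli and the substitution `x = y + z`
  have hF : AEMeasurable (fun p : UnitAddTorus d × UnitAddTorus d =>
      ‖θ p.2‖ₑ * ENNReal.ofReal (kernel ε (p.1 - p.2)) * ‖u p.2 - u p.1‖ₑ) (volume.prod volume) := by
    have hθ2 : AEStronglyMeasurable (fun p : UnitAddTorus d × UnitAddTorus d => θ p.2) (volume.prod volume) :=
      hθ.1.comp_snd
    have hu2 : AEStronglyMeasurable (fun p : UnitAddTorus d × UnitAddTorus d => u p.2) (volume.prod volume) :=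
      hu.1.comp_snd
    have hu1 : AEStronglyMeasurable (fun p : UnitAddTorus d × UnitAddTorus d => u p.1) (volume.prod volume) :=
      hu.1.comp_fst
    have hkm : Measurable fun p : UnitAddTorus d × UnitAddTorus d => ENNReal.ofReal (kernel ε (p.1 - p.2)) :=
      ENNReal.measurable_ofReal.comp (hk.measurable.comp (measurable_fst.sub measurable_snd))
    exact (hθ2.enorm.mul hkm.aemeasurable).mul (hu2.sub hu1).enorm
  have h2 : ∫⁻ x, ∫⁻ y, ‖θ y‖ₑ * ENNReal.ofReal (kernel ε (x - y)) * ‖u y - u x‖ₑ =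
      ∫⁻ z, ENNReal.ofReal (kernel ε z) * ∫⁻ y, ‖θ y‖ₑ * ‖u (y + z) - u y‖ₑ := by
    rw [lintegral_lintegral_swap hF]
    have e1 : ∀ y, ∫⁻ x, ‖θ y‖ₑ * ENNReal.ofReal (kernel ε (x - y)) * ‖u y - u x‖ₑ =
        ∫⁻ z, ‖θ y‖ₑ * ENNReal.ofReal (kernel ε z) * ‖u (y + z) - u y‖ₑ := fun y => by
      have := lintegral_add_right_eq_self (μ := (volume : Measure (UnitAddTorus d)))
        (fun x => ‖θ y‖ₑ * ENNReal.ofReal (kernel ε (x - y)) * ‖u y - u x‖ₑ) y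
      rw [← this]
      refine lintegral_congr fun z => ?_
      simp only [add_sub_cancel_right]
      rw [add_comm z y, enorm_sub_rev]
    simp_rw [e1]
    -- swap back
    have hF2 : AEMeasurable (fun p : UnitAddTorus d × UnitAddTorus d =>
        ‖θ p.1‖ₑ * ENNReal.ofReal (kernel ε p.2) * ‖u (p.1 + p.2) - u p.1‖ₑ) (volume.prod volume) := by
      have hθ1 : AEStronglyMeasurable (fun p : UnitAddTorus d × UnitAddTorus d => θ p.1) (volume.prod volume) :=
        hθ.1.comp_fst
      have hu1 : AEStronglyMeasurable (fun p : UnitAddTorus d × UnitAddTorus d => u p.1) (volume.prod volume) :=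
        hu.1.comp_fst
      have huadd : AEStronglyMeasurable (fun p : UnitAddTorus d × UnitAddTorus d => u (p.1 + p.2))
          (volume.prod volume) :=
        hu.1.comp_quasiMeasurePreserving (quasiMeasurePreserving_add volume volume)
      have hkm : Measurable fun p : UnitAddTorus d × UnitAddTorus d => ENNReal.ofReal (kernel ε p.2) :=
        ENNReal.measurable_ofReal.comp (hk.measurable.comp measurable_snd)
      exact (hθ1.enorm.mul hkm.aemeasurable).mul (huadd.sub hu1).enorm
    rw [lintegral_lintegral_swap hF2]
    refine lintegral_congr fun z => ?_
    rw [← lintegral_const_mul' _ _ ENNReal.ofReal_ne_top]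
    refine lintegral_congr fun y => ?_
    ring
  -- Step 3: Cauchy–Schwarz in `y` and the translation bound
  have h3 : ∀ z : UnitAddTorus d, ∫⁻ y, ‖θ y‖ₑ * ‖u (y + z) - u y‖ₑ ≤
      eLpNorm θ 2 volume * (ENNReal.ofReal ‖reprc z‖ * G) := fun z => by
    have hm : AEStronglyMeasurable (fun y => u (y + z) - u y) volume :=
      (hu.comp_measurePreserving (measurePreserving_add_right volume z)).1.sub hu.1
    have hcs := ENNReal.lintegral_mul_le_Lp_mul_Lq volume Real.HolderConjugate.two_two
      hθ.1.enorm hm.enorm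
    refine hcs.trans ?_
    rw [eLpNorm_eq_lintegral_rpow_enorm_toReal two_ne_zero ENNReal.ofNat_ne_top]
    simp only [ENNReal.toReal_ofNat, one_div]
    gcongr
    have ht := eLpNorm_sub_translate_le hu (reprc z)
    rw [proj_reprc, eLpNorm_eq_lintegral_rpow_enorm_toReal two_ne_zero ENNReal.ofNat_ne_top] at ht
    simpa only [ENNReal.toReal_ofNat, one_div, hG] using ht
  -- Step 4: on the support of the kernel `‖reprc z‖ ≤ √d ε`
  have h4 : ∀ z : UnitAddTorus d, ENNReal.ofReal (kernel ε z) * (eLpNorm θ 2 volume * (ENNReal.ofReal ‖reprc z‖ * G)) ≤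
      ENNReal.ofReal (kernel ε z) * (eLpNorm θ 2 volume *
        (ENNReal.ofReal (Real.sqrt (Fintype.card d) * ε) * G)) := fun z => by
    rcases le_or_gt ε ‖z‖ with hz | hz
    · rw [kernel_eq_zero_of_le hε hz, ENNReal.ofReal_zero, zero_mul, zero_mul]
    · have hz' : ‖reprc z‖ ≤ Real.sqrt (Fintype.card d) * ε :=
        (norm_reprc_le_sqrt_card_mul_norm z).trans (mul_le_mul_of_nonneg_left hz.le (Real.sqrt_nonneg _))
      gcongr
  calc ∫⁻ x, ‖(∫ y, (θ y * kernel ε (x - y)) • u y) - (θ ⋆ kernel ε) x • u x‖ₑ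
      ≤ ∫⁻ x, ∫⁻ y, ‖θ y‖ₑ * ENNReal.ofReal (kernel ε (x - y)) * ‖u y - u x‖ₑ := lintegral_mono h1
    _ = ∫⁻ z, ENNReal.ofReal (kernel ε z) * ∫⁻ y, ‖θ y‖ₑ * ‖u (y + z) - u y‖ₑ := h2
    _ ≤ ∫⁻ z, ENNReal.ofReal (kernel ε z) * (eLpNorm θ 2 volume *
          (ENNReal.ofReal (Real.sqrt (Fintype.card d) * ε) * G)) :=
        lintegral_mono fun z => (mul_le_mul' le_rfl (h3 z)).trans (h4 z)
    _ = ENNReal.ofReal (Real.sqrt (Fintype.card d) * ε) * eLpNorm θ 2 volume * G := by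
        rw [lintegral_mul_const _ hk.measurable.ennreal_ofReal,
          ← ofReal_integral_eq_lintegral_ofReal hk.integrable_unitAddTorus
            (Eventually.of_forall fun z => kernel_nonneg hε.le z),
          integral_kernel hε hε', ENNReal.ofReal_one, one_mul]
        ring

end Commutator

end Torus

end Literature.Analysis.FunctionSpaces
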